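import Summits.HubbardSuperconductivity.HubbardSuperconductivity.Theorems.AnisotropyChordTransferFibre3KT2aRow
import Summits.HubbardSuperconductivity.HubbardSuperconductivity.Theorems.AnisotropyChordTransferFibre3OneLoop

/-!
# Route `AnisotropyChord` / H0 rotor rung: PartN41-D — the convolution identities `PairConvolution` and `PiHatConvolution` PROVED

Theory-1 g22's PartN41-D (port …Fibre3KT2aRow): ★ `pairConvolution_holds : PairConvolution L`
(`FT[F·G](q) = (1/V)Σ_p F̂(p)Ĝ(q − p)`, the two-function version of the landed `fsqFourier_holds`, same character bookkeeping
`conj_phase_pair`/`sum_conj_phase_left`) and ★ `piHatConvolution_holds : PiHatConvolution L` (= the landed `piHatOneLoop_holds`,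
`PiHat = cfgDFT Π⁰`).
Prover seat `hubbard-h0-rotor-p1` g27 (route lead); helper for stmt-HubbardSuperconductivity-23918 (`--supports`, helper class).
WHAT THIS IS NOT: nothing here proves superconductivity in the Hubbard model.  Tree imports only; no new definitions; no sorry.
-/

set_option linter.dupNamespace false
set_option autoImplicit false

noncomputable section

open scoped BigOperators

namespace Summit.HubbardSuperconductivity.HubbardSuperconductivity.Theorems.AnisotropyChord.Transfer.Fibre3

variable (L : ℕ) [NeZero L]

/-- ★ **`PairConvolution L` holds:** `FT[F·G](q) = (1/V)Σ_p F̂(p)Ĝ(q−p)`. [folklore] -/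
theorem pairConvolution_holds : PairConvolution L := by
  intro F G q
  have hV : ((L : ℂ) ^ 2) ≠ 0 := by
    have : (L : ℂ) ≠ 0 := by exact_mod_cast (NeZero.ne L)
    positivity
  rw [eq_div_iff hV]
  unfold pairZ dft
  -- expand the product of sums
  have e1 : ∑ p : Tor L, (∑ r : Tor L, (starRingEnd ℂ) (phase L p r) * (F r : ℂ))
        * (∑ s : Tor L, (starRingEnd ℂ) (phase L (q - p) s) * (G s : ℂ))
      = ∑ r : Tor L, ∑ s : Tor L, ((F r : ℂ) * (G s : ℂ) * (starRingEnd ℂ) (phase L q s))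
          * ∑ p : Tor L, (starRingEnd ℂ) (phase L p (r - s)) := by
    calc ∑ p : Tor L, (∑ r : Tor L, (starRingEnd ℂ) (phase L p r) * (F r : ℂ))
          * (∑ s : Tor L, (starRingEnd ℂ) (phase L (q - p) s) * (G s : ℂ))
        = ∑ p : Tor L, ∑ r : Tor L, ∑ s : Tor L,
            ((F r : ℂ) * (G s : ℂ) * (starRingEnd ℂ) (phase L q s)) * (starRingEnd ℂ) (phase L p (r - s)) := by
          refine Finset.sum_congr rfl fun p _ => ?_
          rw [Finset.sum_mul_sum]
          refine Finset.sum_congr rfl fun r _ => Finset.sum_congr rfl fun s _ => ?_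
          have := conj_phase_pair L p q r s
          calc (starRingEnd ℂ) (phase L p r) * (F r : ℂ) * ((starRingEnd ℂ) (phase L (q - p) s) * (G s : ℂ))
              = ((starRingEnd ℂ) (phase L p r) * (starRingEnd ℂ) (phase L (q - p) s)) * ((F r : ℂ) * (G s : ℂ)) := by ring
            _ = _ := by rw [this]; ring
      _ = ∑ r : Tor L, ∑ p : Tor L, ∑ s : Tor L,
            ((F r : ℂ) * (G s : ℂ) * (starRingEnd ℂ) (phase L q s)) * (starRingEnd ℂ) (phase L p (r - s)) :=
          Finset.sum_comm
      _ = ∑ r : Tor L, ∑ s : Tor L, ∑ p : Tor L,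
            ((F r : ℂ) * (G s : ℂ) * (starRingEnd ℂ) (phase L q s)) * (starRingEnd ℂ) (phase L p (r - s)) := by
          refine Finset.sum_congr rfl fun r _ => ?_; exact Finset.sum_comm
      _ = _ := by
          refine Finset.sum_congr rfl fun r _ => Finset.sum_congr rfl fun s _ => ?_
          rw [Finset.mul_sum]
  rw [e1]
  -- the character sum kills `s ≠ r`
  have e2 : ∀ r : Tor L, ∑ s : Tor L, ((F r : ℂ) * (G s : ℂ) * (starRingEnd ℂ) (phase L q s))
        * ∑ p : Tor L, (starRingEnd ℂ) (phase L p (r - s))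
      = (starRingEnd ℂ) (phase L q r) * (((F r * G r : ℝ)) : ℂ) * (L : ℂ) ^ 2 := by
    intro r
    simp_rw [sum_conj_phase_left, sub_eq_zero]
    have : ∀ s : Tor L, ((F r : ℂ) * (G s : ℂ) * (starRingEnd ℂ) (phase L q s)) * (if r = s then ((L : ℂ) ^ 2) else 0)
        = if r = s then (F r : ℂ) * (G s : ℂ) * (starRingEnd ℂ) (phase L q s) * (L : ℂ) ^ 2 else 0 := by
      intro s; split_ifs <;> ring
    rw [Finset.sum_congr rfl fun s _ => this s, Finset.sum_ite_eq Finset.univ r]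
    simp only [Finset.mem_univ, if_true]
    push_cast; ring
  rw [Finset.sum_congr rfl fun r _ => e2 r, ← Finset.sum_mul]

/-- ★ **`PiHatConvolution L` holds** (= `piHatOneLoop_holds`). [folklore] -/
theorem piHatConvolution_holds : PiHatConvolution L := by
  intro f q₂ q₃
  unfold PiHat
  exact piHatOneLoop_holds L f q₂ q₃

end Summit.HubbardSuperconductivity.HubbardSuperconductivity.Theorems.AnisotropyChord.Transfer.Fibre3

end
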